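import Literature.NumberTheory.Transcendental.NesterenkoEliminationChartsK
import Literature.NumberTheory.Transcendental.NesterenkoChowFormPrime
import Mathlib.Algebra.MvPolynomial.PDeriv
import Mathlib.RingTheory.UniqueFactorizationDomain.Multiplicity
import HarnessLib

/-!
# The associated form of a homogeneous PRIMARY ideal over an ARBITRARY field of characteristic zero: `Q̄(r) = (F^k)` (LNM 1752 Ch. 3 Prop. 4.4) — proofs

`Literature/NumberTheory/Transcendental/NesterenkoEliminationPrimaryFormK.lean`. GENERIC-FIELD PORT
of the tree's `NesterenkoEliminationPrimaryForm.lean` (hard-wired to `ℚ[x̲]`): the same proofs with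
`ℚ ↦ K`, `K` any field of CHARACTERISTIC ZERO (the induction differentiates `f^{a+1}`), for the
generic objects `NesterenkoK.elimIdeal` (`NesterenkoElimIdealPrime.lean`) and the generic chart
toolkit `NesterenkoEliminationChartsK.lean` (`sigmaU K r m c`). Chapter 10 of the book runs Ch. 3
§4 over `K = ℂ(z)` (p. 153); this is input (h3) of the generic-field Proposition 4.4.

Let `𝔭 ⊂ K[x₀, …, x_m]` be a homogeneous prime with `dim K[x̲] ⧸ 𝔭 = r ≥ 1`, `p̄(r) = (F)` its
elimination ideal (principal and prime: `NesterenkoK.isPrincipal_elimIdeal`,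
`NesterenkoChowFormPrime.lean`; generic copies of the four lemmas of
`NesterenkoEliminationPrimeForm.lean` that are needed — `exists_X_notMem_of_rank`,
`elimIdeal_eq_comap_sigmaU`, `irreducible_of_span_eq_elimIdeal` and two private generalities — open
the file), and `Q` a homogeneous `𝔭`-primary ideal with EXPONENT `k` (the least `k` with `𝔭ᵏ ⊆ Q`;
here passed explicitly as `k` with `0 < k`, `𝔭ᵏ ⊆ Q` and minimality, so that the file does not
depend on a particular definition of the exponent — `NesterenkoK.primaryExponent` qualifies by
`radical_pow_primaryExponent_le` / `primaryExponent_le`). We prove the primary case of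
Nesterenko–Philippon (eds.), LNM 1752, Ch. 3 Prop. 4.4: **`Q̄(r) = elimIdeal Q r = (F^k)`**
(`NesterenkoK.elimIdeal_eq_span_pow_of_isPrimary`).

`F^k ∈ Q̄(r)` is formal (`(𝔭, L)ᵏ ⊆ (𝔭ᵏ, L) ⊆ (Q, L)`). The content is the converse: if
`F^a · G' ∈ Q̄(r)` with `F ∤ G'` then `𝔭ᵃ ⊆ Q`. Our proof (elementary, through the chart `x_c ∉ 𝔭`
of `NesterenkoEliminationChartsK.lean`; we do not know whether it is the argument of [Nes2]) runs in
`T = K[y][u_{ij} : j ≠ c]` with `f = σ_c(F) ∈ 𝔭' T` and the partial derivatives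
`∂_{ij'} = ∂/∂u_{ij'}` (`MvPolynomial.pderiv`, `K[y]`-linear, so `𝔭' T` and `Q' T` are stable):

* chain rule (`pderiv_sigmaU`): `∂_{ij'} σ_c(G) = σ_c(∂G/∂u_{i,c.succAbove j'}) − y_{j'} σ_c(∂G/∂u_{ic})`;
* gradient identity (`aeval_pderiv_mem_elimIdeal`): for a form `P ∈ 𝔭` and a block `i`,
  `P(∂F/∂u_{i0}, …, ∂F/∂u_{im}) ∈ (F)` — under `σ_c` the point `(σ_c ∂F/∂u_{ij})ⱼ` is congruent
  modulo `𝔭' T` to `g · (yⱼ)ⱼ` (`y_c = 1`), `g = σ_c(∂F/∂u_{ic})`, and `P(g y) = gᵉ P(y) ∈ 𝔭' T`;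
* KEY (`pow_mul_C_mem_of_mem`): every ideal `𝔅 ∋ f, ∂_{i•} f` contains `gᵉ · P(x_c := 1)` for all
  forms `P ∈ 𝔭` of degree `e` (same congruence modulo `𝔅`, and `P(∇ᵢF) = F · H`);
* induction (`map_pow_le_of_pow_mem`): an ideal `𝔍 ⊆ T` stable under the `∂_{ij'}` and saturated
  with respect to `g` which contains `fᵃ` contains `(𝔭' T)ᵃ` — with `𝔅 = (𝔍 : fᵃ) ∋ f, ∂f`
  (as `∂(f^{a+1}) = (a+1) fᵃ ∂f`, characteristic `0`), KEY gives `P(x_c:=1) fᵃ ∈ 𝔍`, and the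
  induction hypothesis applies to `(𝔍 : P(x_c := 1))`;
* applied to the `𝔭' T`-saturation `𝔍` of `Q' T` (`g ∉ 𝔭' T` because `∂F/∂u_{ic} ∉ (F)` for a
  block `i` in which `u_{ic}` occurs in `F`, `exists_pderiv_notMem_span`), and pulled back to
  `K[x̲]` through the primary ideal `Q'` (`pow_le_of_exists_mul_pow_mem`): `𝔭ᵃ ⊆ Q`, so `k ≤ a`.

No new definitions, no named facts.

## References

* [NesterenkoPhilippon2001] Yu. V. Nesterenko, P. Philippon (eds.), *Introduction to Algebraic
  Independence Theory*, LNM 1752, Springer 2001, Ch. 3 §4, Prop. 4.4 (p. 38); Ch. 10 p. 175 (the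
  exponent of a primary ideal).
-/

noncomputable section

open MvPolynomial
open Literature.AlgebraicGeometry.Motives

attribute [local instance] MvPolynomial.gradedAlgebra

namespace Literature.NumberTheory.Transcendental

namespace NesterenkoK

variable {K : Type*} [Field K] {m : ℕ}

/-! ### Generalities (generic-field copies of lemmas of `NesterenkoEliminationPrimeForm.lean`) -/

/-- The extension `I·A[σ]` of a prime ideal `I ⊂ A` to a polynomial ring is prime
(`A[σ] ⧸ I A[σ] ≅ (A ⧸ I)[σ]` is a domain). [folklore] -/
private theorem isPrime_map_C {A σ : Type*} [CommRing A] {I : Ideal A} (hI : I.IsPrime) :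
    (I.map (C : A →+* MvPolynomial σ A)).IsPrime := by
  have h : I.map (C : A →+* MvPolynomial σ A) =
      RingHom.ker (MvPolynomial.map (σ := σ) (Ideal.Quotient.mk I)) := by
    rw [MvPolynomial.ker_map, Ideal.mk_ker]
  rw [h]
  haveI := hI
  exact RingHom.ker_isPrime _

/-- Cancelling a constant factor in `I·A[σ]`: if `a y ∈ I ⇒ a ∈ I` on `A`, then
`f · C y ∈ I A[σ] ⇒ f ∈ I A[σ]` (coefficientwise). [folklore] -/
private theorem mem_map_C_of_mul_C_mem {A σ : Type*} [CommRing A] {I : Ideal A} {y : A}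
    (hy : ∀ a, a * y ∈ I → a ∈ I) {f : MvPolynomial σ A}
    (h : f * C y ∈ I.map (C : A →+* MvPolynomial σ A)) : f ∈ I.map (C : A →+* MvPolynomial σ A) := by
  rw [mem_map_C_iff] at h ⊢
  intro α
  have := h α
  rw [mul_comm, coeff_C_mul, mul_comm] at this
  exact hy _ this

/-- A prime `𝔭` with `dim K[x̲] ⧸ 𝔭 = r ≥ 1` does not contain all the variables: some chart
`x_c ∉ 𝔭` exists. [folklore] -/
theorem exists_X_notMem_of_rank {𝔭 : Ideal (MvPolynomial (Fin (m + 1)) K)} (h𝔭 : 𝔭.IsPrime)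
    {r : ℕ} (hr : 1 ≤ r) (hdim : ringKrullDim (MvPolynomial (Fin (m + 1)) K ⧸ 𝔭) = r) :
    ∃ c, (X c : MvPolynomial (Fin (m + 1)) K) ∉ 𝔭 := by
  haveI := h𝔭
  refine Literature.RingTheory.MvPolynomial.exists_X_notMem_of_ringKrullDim_ne_zero ?_
  rw [hdim]
  have : (r : WithBot ℕ∞) ≠ 0 := by exact_mod_cast (show r ≠ 0 by omega)
  exact this

/-- **`p̄(r) = σ_c⁻¹(𝔭'_c T)` for every chart `x_c ∉ 𝔭`** (any number `r` of linear forms; any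
field): the condition on the chart `c` alone implies the condition on all charts.
[cite: NesterenkoPhilippon2001, Ch. 3 Def. 4.3 (p. 38)] -/
theorem elimIdeal_eq_comap_sigmaU {𝔭 : Ideal (MvPolynomial (Fin (m + 1)) K)} (h𝔭 : 𝔭.IsPrime)
    (hhom : 𝔭.IsHomogeneous (homogeneousSubmodule (Fin (m + 1)) K)) {c : Fin (m + 1)}
    (hc : (X c : MvPolynomial (Fin (m + 1)) K) ∉ 𝔭) (r : ℕ) :
    elimIdeal 𝔭 r = ((affIdeal c 𝔭).map (C : MvPolynomial (Fin m) K →+*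
      MvPolynomial (Fin r × Fin m) (MvPolynomial (Fin m) K))).comap (sigmaU K r m c) := by
  ext G
  rw [Ideal.mem_comap]
  refine ⟨fun hG => sigmaU_mem_of_mem_elimIdeal c hG, fun hG => ?_⟩
  rw [mem_elimIdeal_iff_forall_sigmaU_mem hhom]
  intro c'
  by_cases hc' : (X c' : MvPolynomial (Fin (m + 1)) K) ∈ 𝔭
  · rw [affIdeal_eq_top_of_X_mem c' hc', Ideal.map_top]
    exact Submodule.mem_top
  obtain ⟨N, -, hN⟩ := exists_mul_X_pow_mem_of_sigmaU_mem c hhom hG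
  have h1 := map_sigmaUX_extIdeal_le r c' 𝔭 (Ideal.mem_map_of_mem (sigmaUX K r m c') hN)
  have hx : sigmaUX K r m c' (X (Sum.inr c)) = C (ProjectiveSpace.dehomogenize K c' (X c)) := by
    simpa using sigmaUX_rename_inr r m c' (X c)
  rw [map_mul, map_pow, sigmaUX_rename_inl, hx, ← map_pow] at h1
  have h𝔭' : (affIdeal c' 𝔭).IsPrime := isPrime_affIdeal h𝔭 hhom hc'
  refine mem_map_C_of_mul_C_mem (fun a ha => (h𝔭'.mem_or_mem ha).resolve_right fun h => ?_) h1
  have := h𝔭'.mem_of_pow_mem N h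
  rw [dehomogenize_mem_affIdeal_iff_of_isPrime h𝔭 hhom hc' (isHomogeneous_X K c)] at this
  exact hc this

/-- Every generator of `p̄(r)` is irreducible (it generates the non-zero prime ideal `p̄(r)`,
`NesterenkoK.isPrincipal_elimIdeal`; `K` infinite). [cite: NesterenkoPhilippon2001, Ch. 3 Prop. 4.4 (p. 38)] -/
theorem irreducible_of_span_eq_elimIdeal [CharZero K] {𝔭 : Ideal (MvPolynomial (Fin (m + 1)) K)}
    (h𝔭 : 𝔭.IsPrime) (hhom : 𝔭.IsHomogeneous (homogeneousSubmodule (Fin (m + 1)) K)) {r : ℕ}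
    (hr : 1 ≤ r) (hdim : ringKrullDim (MvPolynomial (Fin (m + 1)) K ⧸ 𝔭) = r)
    {F : MvPolynomial (Fin r × Fin (m + 1)) K} (hF : Ideal.span {F} = elimIdeal 𝔭 r) :
    Irreducible F := by
  haveI := h𝔭
  haveI : Infinite K := Infinite.of_injective _ Nat.cast_injective
  obtain ⟨-, hne, hprime⟩ := isPrincipal_elimIdeal 𝔭 hhom hr hdim
  have hF0 : F ≠ 0 := by
    intro h0
    apply hne
    rw [← hF, h0, Ideal.span_singleton_eq_bot]
  rw [← hF] at hprime
  exact ((Ideal.span_singleton_prime hF0).mp hprime).irreducible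

/-! ### Partial derivatives `∂/∂u_{ij'}` on `T` -/

/-- Extended ideals `I·A[σ]` are stable under the `A`-linear partial derivatives. [folklore] -/
theorem pderiv_mem_map_C {A σ : Type*} [CommRing A] {I : Ideal A} (v : σ) {g : MvPolynomial σ A}
    (hg : g ∈ I.map (C : A →+* MvPolynomial σ A)) :
    pderiv v g ∈ I.map (C : A →+* MvPolynomial σ A) := by
  rw [mem_map_C_iff] at hg ⊢
  intro β
  rw [coeff_pderiv]
  exact I.mul_mem_right _ (hg _)

/-- The partial derivatives of the values of `σ_c` on the variables:
`∂_{ij'} σ_c(u_v) = [v = (i, c.succAbove j')] − y_{j'} [v = (i, c)]`. [folklore] -/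
theorem pderiv_sigmaUVal {r : ℕ} (c : Fin (m + 1)) (i : Fin r) (j' : Fin m)
    (v : Fin r × Fin (m + 1)) :
    pderiv (i, j') (sigmaUVal K r m c v) =
      (if v = (i, c.succAbove j') then 1 else 0) - C (X j') * (if v = (i, c) then 1 else 0) := by
  classical
  obtain ⟨i₁, j⟩ := v
  rcases Fin.eq_self_or_eq_succAbove c j with hj | ⟨j₀, hj⟩ <;> subst j
  · have hne : ((i₁, c) : Fin r × Fin (m + 1)) ≠ (i, c.succAbove j') := fun h =>
      Fin.succAbove_ne c j' (Prod.mk.inj h).2.symm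
    rw [sigmaUVal_same, if_neg hne, zero_sub, wForm, map_neg, map_sum]
    have hx : ∀ x : Fin m, pderiv (i, j') (X (i₁, x) * C (X x) : (MvPolynomial (Fin r × Fin m) (MvPolynomial (Fin m) K))) =
        if ((i₁, x) : Fin r × Fin m) = (i, j') then C (X x) else 0 := fun x => by
      rw [Derivation.leibniz, pderiv_C, smul_zero, zero_add, pderiv_X, smul_eq_mul, Pi.single_apply]
      split_ifs <;> simp
    simp only [hx]
    by_cases hi : i₁ = i
    · subst hi
      rw [Finset.sum_eq_single j' (fun x _ hx => if_neg (by simpa using hx)) (by simp), if_pos rfl,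
        if_pos rfl]
      ring
    · rw [Finset.sum_eq_zero (fun x _ => if_neg (by simp [hi])), if_neg (by simp [hi])]
      ring
  · have hne : ((i₁, c.succAbove j₀) : Fin r × Fin (m + 1)) ≠ (i, c) := fun h =>
      Fin.succAbove_ne c j₀ (Prod.mk.inj h).2
    rw [sigmaUVal_succAbove, if_neg hne, mul_zero, sub_zero, pderiv_X, Pi.single_apply]
    congr 1
    simp [Prod.ext_iff]

/-- **Chain rule for `σ_c`**: `∂_{ij'} σ_c(G) = σ_c(∂G/∂u_{i, c.succAbove j'}) − y_{j'} · σ_c(∂G/∂u_{ic})`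
(the variable `u_{ic}` was replaced by `wᵢ = −∑ u_{ij'} y_{j'}`). [folklore] -/
theorem pderiv_sigmaU {r : ℕ} (c : Fin (m + 1)) (i : Fin r) (j' : Fin m) (G : (MvPolynomial (Fin r × Fin (m + 1)) K)) :
    pderiv (i, j') (sigmaU K r m c G) =
      sigmaU K r m c (pderiv (i, c.succAbove j') G) - C (X j') * sigmaU K r m c (pderiv (i, c) G) := by
  classical
  induction G using MvPolynomial.induction_on with
  | C a =>
    rw [pderiv_C, pderiv_C, map_zero, mul_zero, sub_zero, sigmaU, aeval_C,
      IsScalarTower.algebraMap_apply K ((MvPolynomial (Fin m) K)) ((MvPolynomial (Fin r × Fin m) (MvPolynomial (Fin m) K))), MvPolynomial.algebraMap_eq, pderiv_C]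
  | add p q hp hq => simp only [map_add, hp, hq]; ring
  | mul_X p v h =>
    simp only [map_mul, Derivation.leibniz, smul_eq_mul, sigmaU_X, map_add, h, pderiv_sigmaUVal,
      pderiv_X, Pi.single_apply, apply_ite (sigmaU K r m c), map_one, map_zero]
    ring

/-- `σ_c` on the gradient point: `j ↦ σ_c(∂F/∂u_{ij})` is congruent, modulo any ideal `𝔅`
containing the `∂_{ij'} σ_c(F)`, to `j ↦ g · xⱼ(x_c := 1)` with `g = σ_c(∂F/∂u_{ic})`. [folklore] -/
theorem sigmaU_pderiv_sub_mem {r : ℕ} (c : Fin (m + 1)) (i : Fin r) (F : (MvPolynomial (Fin r × Fin (m + 1)) K))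
    {𝔅 : Ideal ((MvPolynomial (Fin r × Fin m) (MvPolynomial (Fin m) K)))} (h𝔅 : ∀ j' : Fin m, pderiv (i, j') (sigmaU K r m c F) ∈ 𝔅) (j : Fin (m + 1)) :
    sigmaU K r m c (pderiv (i, j) F) -
      sigmaU K r m c (pderiv (i, c) F) * C (ProjectiveSpace.dehomogenize K c (X j)) ∈ 𝔅 := by
  rcases Fin.eq_self_or_eq_succAbove c j with hj | ⟨j', hj⟩ <;> subst j
  · rw [ProjectiveSpace.dehomogenize_X_self, C_1, mul_one, sub_self]
    exact zero_mem _
  · rw [ProjectiveSpace.dehomogenize_X_succAbove, mul_comm, ← pderiv_sigmaU]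
    exact h𝔅 j'

/-- Substituting `xⱼ ↦ xⱼ(x_c := 1)` (as constants of `T`) is dehomogenisation. [folklore] -/
theorem aeval_C_dehomogenize_X {r : ℕ} (c : Fin (m + 1)) (P : (MvPolynomial (Fin (m + 1)) K)) :
    aeval (fun j => (C (ProjectiveSpace.dehomogenize K c (X j)) : (MvPolynomial (Fin r × Fin m) (MvPolynomial (Fin m) K)))) P =
      C (ProjectiveSpace.dehomogenize K c P) := by
  rw [← sigmaUX_rename_inr r m c P, sigmaUX, aeval_rename]
  rfl

/-- **KEY.** Let `𝔅 ⊆ T` be an ideal containing `σ_c(P(∇ᵢF))` and the `∂_{ij'} σ_c(F)`, `j' < m`, for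
a form `P` of degree `e` and a block `i`. Then `gᵉ · P(x_c := 1) ∈ 𝔅`, `g = σ_c(∂F/∂u_{ic})`
(`P` at congruent points takes congruent values, and `P(g y) = gᵉ P(y)`). [folklore] -/
theorem pow_mul_C_mem_of_mem {r : ℕ} (c : Fin (m + 1)) (i : Fin r) (F : (MvPolynomial (Fin r × Fin (m + 1)) K))
    {𝔅 : Ideal ((MvPolynomial (Fin r × Fin m) (MvPolynomial (Fin m) K)))} (h𝔅 : ∀ j' : Fin m, pderiv (i, j') (sigmaU K r m c F) ∈ 𝔅)
    {P : (MvPolynomial (Fin (m + 1)) K)} {e : ℕ} (hP : P.IsHomogeneous e)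
    (hPF : sigmaU K r m c (aeval (fun j => pderiv (i, j) F) P) ∈ 𝔅) :
    sigmaU K r m c (pderiv (i, c) F) ^ e * C (ProjectiveSpace.dehomogenize K c P) ∈ 𝔅 := by
  have h1 := aeval_sub_aeval_mem_of_forall_sub_mem (sigmaU_pderiv_sub_mem c i F h𝔅) P
  rw [ProjectiveSpace.isHomogeneous_aeval_const_mul hP, aeval_C_dehomogenize_X,
    show aeval (fun j => sigmaU K r m c (pderiv (i, j) F)) P =
      sigmaU K r m c (aeval (fun j => pderiv (i, j) F) P) by
        rw [← AlgHom.comp_apply, MvPolynomial.comp_aeval]] at h1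
  have := 𝔅.sub_mem hPF h1
  rwa [sub_sub_cancel] at this

/-! ### The gradient identity `P(∇ᵢ F) ∈ (F)` for forms `P ∈ 𝔭` -/

section Prime

variable {𝔭 : Ideal (MvPolynomial (Fin (m + 1)) K)} {r : ℕ} {c : Fin (m + 1)} {F : (MvPolynomial (Fin r × Fin (m + 1)) K)}

/-- `σ_c(F) ∈ 𝔭' T` for `F ∈ p̄(r)`, and so are its partial derivatives. [folklore] -/
theorem pderiv_sigmaU_mem (hF : Ideal.span {F} = elimIdeal 𝔭 r) (i : Fin r) (j' : Fin m) :
    pderiv (i, j') (sigmaU K r m c F) ∈ (affIdeal c 𝔭).map (C : (MvPolynomial (Fin m) K) →+* (MvPolynomial (Fin r × Fin m) (MvPolynomial (Fin m) K))) :=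
  pderiv_mem_map_C _ (sigmaU_mem_of_mem_elimIdeal c (hF ▸ Ideal.mem_span_singleton_self F))

/-- **Gradient identity.** For a homogeneous prime `𝔭` with `p̄(r) = (F)`, a chart `x_c ∉ 𝔭`, a form
`P ∈ 𝔭` and a block `i`: `P(∂F/∂u_{i0}, …, ∂F/∂u_{im}) ∈ (F)` (classically: the gradient of the
Chow form in one block of variables is a point of the variety). Proof: `p̄(r) = σ_c⁻¹(𝔭' T)` and
modulo `𝔭' T` the point `σ_c(∇ᵢF)` is `g · y` with `P(g y) = gᵉ P(x_c := 1) ∈ 𝔭' T`.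
[cite: NesterenkoPhilippon2001, Ch. 3 Prop. 4.4 (p. 38)] -/
theorem aeval_pderiv_mem_elimIdeal (h𝔭 : 𝔭.IsPrime)
    (hhom : 𝔭.IsHomogeneous (homogeneousSubmodule (Fin (m + 1)) K)) (hc : (X c : (MvPolynomial (Fin (m + 1)) K)) ∉ 𝔭)
    (hF : Ideal.span {F} = elimIdeal 𝔭 r) {P : (MvPolynomial (Fin (m + 1)) K)} {e : ℕ} (hP : P.IsHomogeneous e)
    (hP𝔭 : P ∈ 𝔭) (i : Fin r) : aeval (fun j => pderiv (i, j) F) P ∈ elimIdeal 𝔭 r := by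
  rw [elimIdeal_eq_comap_sigmaU h𝔭 hhom hc r, Ideal.mem_comap]
  set 𝔅 : Ideal ((MvPolynomial (Fin r × Fin m) (MvPolynomial (Fin m) K))) := (affIdeal c 𝔭).map (C : (MvPolynomial (Fin m) K) →+* (MvPolynomial (Fin r × Fin m) (MvPolynomial (Fin m) K)))
  have h1 := aeval_sub_aeval_mem_of_forall_sub_mem
    (sigmaU_pderiv_sub_mem c i F (fun j' => pderiv_sigmaU_mem hF i j')) P
  rw [ProjectiveSpace.isHomogeneous_aeval_const_mul hP, aeval_C_dehomogenize_X,
    show aeval (fun j => sigmaU K r m c (pderiv (i, j) F)) P =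
      sigmaU K r m c (aeval (fun j => pderiv (i, j) F) P) by
        rw [← AlgHom.comp_apply, MvPolynomial.comp_aeval]] at h1
  have h2 : sigmaU K r m c (pderiv (i, c) F) ^ e * C (ProjectiveSpace.dehomogenize K c P) ∈ 𝔅 :=
    Ideal.mul_mem_left _ _ (Ideal.mem_map_of_mem _ (dehomogenize_mem_affIdeal c hP𝔭))
  have := 𝔅.add_mem h1 h2
  rwa [sub_add_cancel] at this

/-- **KEY, for `𝔭`.** Any ideal `𝔅 ⊆ T` containing `f = σ_c(F)` and its derivatives `∂_{ij'} f`
contains `gᵉ · P(x_c := 1)` for every form `P ∈ 𝔭` of degree `e` (so `𝔭' T ⊆ (f, ∂_{i•} f) : g^∞`: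
"the incidence variety is cut out by the Chow form and its first derivatives in one block").
[cite: NesterenkoPhilippon2001, Ch. 3 Prop. 4.4 (p. 38)] -/
theorem pow_mul_C_mem_of_isPrime (h𝔭 : 𝔭.IsPrime)
    (hhom : 𝔭.IsHomogeneous (homogeneousSubmodule (Fin (m + 1)) K)) (hc : (X c : (MvPolynomial (Fin (m + 1)) K)) ∉ 𝔭)
    (hF : Ideal.span {F} = elimIdeal 𝔭 r) {𝔅 : Ideal ((MvPolynomial (Fin r × Fin m) (MvPolynomial (Fin m) K)))} (hf : sigmaU K r m c F ∈ 𝔅) {i : Fin r}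
    (h𝔅 : ∀ j' : Fin m, pderiv (i, j') (sigmaU K r m c F) ∈ 𝔅) {P : (MvPolynomial (Fin (m + 1)) K)} {e : ℕ}
    (hP : P.IsHomogeneous e) (hP𝔭 : P ∈ 𝔭) :
    sigmaU K r m c (pderiv (i, c) F) ^ e * C (ProjectiveSpace.dehomogenize K c P) ∈ 𝔅 := by
  refine pow_mul_C_mem_of_mem c i F h𝔅 hP ?_
  have h := aeval_pderiv_mem_elimIdeal h𝔭 hhom hc hF hP hP𝔭 i
  rw [← hF, Ideal.mem_span_singleton] at h
  obtain ⟨H, hH⟩ := h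
  rw [hH, map_mul]
  exact Ideal.mul_mem_right _ _ hf

/-! ### A block `i` with `∂F/∂u_{ic} ∉ (F)` -/

/-- A partial derivative lowers the total degree. [folklore] -/
theorem totalDegree_pderiv_lt {σ : Type*} {p : MvPolynomial σ K} {v : σ} (h : pderiv v p ≠ 0) :
    (pderiv v p).totalDegree < p.totalDegree := by
  classical
  obtain ⟨β, hβ⟩ := MvPolynomial.ne_zero_iff.mp h
  have key : ∀ β ∈ (pderiv v p).support, (β.sum fun _ e => e) + 1 ≤ p.totalDegree := by
    intro β hβ
    rw [mem_support_iff, coeff_pderiv] at hβ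
    have hmem : β + Finsupp.single v 1 ∈ p.support := by
      rw [mem_support_iff]
      exact left_ne_zero_of_mul hβ
    have := le_totalDegree hmem
    rw [Finsupp.sum_add_index' (fun _ => rfl) (fun _ _ _ => rfl), Finsupp.sum_single_index rfl] at this
    exact this
  have hp : 1 ≤ p.totalDegree := le_trans (by omega) (key β (mem_support_iff.mpr hβ))
  rw [totalDegree]
  exact (Finset.sup_le fun β hβ => Nat.le_sub_one_of_lt (key β hβ)).trans_lt (by omega)

/-- A non-zero partial derivative of `F` is not a multiple of `F`. [folklore] -/
theorem pderiv_notMem_span {σ : Type*} {F : MvPolynomial σ K} {v : σ} (h : pderiv v F ≠ 0) :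
    pderiv v F ∉ Ideal.span {F} := by
  rw [Ideal.mem_span_singleton]
  intro hdvd
  exact lt_irrefl _ (lt_of_lt_of_le (totalDegree_pderiv_lt h) (totalDegree_le_of_dvd_of_isDomain hdvd h))

/-- If `u_v` occurs in `F` then `∂F/∂u_v ≠ 0` (characteristic zero). [folklore] -/
theorem pderiv_ne_zero_of_mem_vars [CharZero K] {σ : Type*} {F : MvPolynomial σ K} {v : σ} (h : v ∈ F.vars) :
    pderiv v F ≠ 0 := by
  classical
  obtain ⟨α, hα, hv⟩ := (mem_vars_iff_mem_support v).mp h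
  rw [MvPolynomial.ne_zero_iff]
  refine ⟨α - Finsupp.single v 1, ?_⟩
  have hle : Finsupp.single v 1 ≤ α := Finsupp.single_le_iff.mpr (Nat.one_le_iff_ne_zero.mpr
    (Finsupp.mem_support_iff.mp hv))
  rw [coeff_pderiv, tsub_add_cancel_of_le hle]
  exact mul_ne_zero (mem_support_iff.mp hα) (Nat.cast_add_one_ne_zero _)

/-- If no variable `u_{ic}` (`i < r`) occurs in `G ≠ 0` then `σ_c(G) ∉ 𝔞 T` for every proper ideal
`𝔞 ⊂ K[y]` (`σ_c` merely renames the variables of `G`, so `σ_c(G)` has a non-zero RATIONAL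
coefficient). [folklore] -/
theorem sigmaU_notMem_of_forall_notMem_vars {G : (MvPolynomial (Fin r × Fin (m + 1)) K)} (hG0 : G ≠ 0)
    (hG : ∀ i : Fin r, (i, c) ∉ G.vars) {𝔞 : Ideal ((MvPolynomial (Fin m) K))} (h𝔞 : 𝔞 ≠ ⊤) :
    sigmaU K r m c G ∉ 𝔞.map (C : (MvPolynomial (Fin m) K) →+* (MvPolynomial (Fin r × Fin m) (MvPolynomial (Fin m) K))) := by
  classical
  -- `G = rename val H`, `H` in the variables `v` with `v.2 ≠ c`
  obtain ⟨H, rfl⟩ := exists_rename_eq_of_vars_subset_range G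
    (Subtype.val : {v : Fin r × Fin (m + 1) // v.2 ≠ c} → Fin r × Fin (m + 1)) Subtype.val_injective
    (fun v hv => ⟨⟨v, fun h => hG v.1 (by rwa [show v = (v.1, c) from Prod.ext rfl h] at hv)⟩, rfl⟩)
  have hH0 : H ≠ 0 := fun h => hG0 (by rw [h, map_zero])
  -- on these variables `σ_c` is the renaming `κ`
  have hκ : ∀ w : {v : Fin r × Fin (m + 1) // v.2 ≠ c}, ∃ j₀ : Fin m, c.succAbove j₀ = w.1.2 :=
    fun w => Fin.exists_succAbove_eq w.2
  choose κ₂ hκ₂ using hκ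
  let κ : {v : Fin r × Fin (m + 1) // v.2 ≠ c} → Fin r × Fin m := fun w => (w.1.1, κ₂ w)
  have hκinj : Function.Injective κ := by
    intro w w' h
    simp only [κ, Prod.mk.injEq] at h
    apply Subtype.ext
    refine Prod.ext h.1 ?_
    rw [← hκ₂ w, ← hκ₂ w', h.2]
  have hval : ∀ w : {v : Fin r × Fin (m + 1) // v.2 ≠ c}, sigmaUVal K r m c w.1 = X (κ w) := by
    intro w
    have : w.1 = (w.1.1, c.succAbove (κ₂ w)) := Prod.ext rfl (hκ₂ w).symm
    rw [this, sigmaUVal_succAbove]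
  have hσ : sigmaU K r m c (rename Subtype.val H) = MvPolynomial.map (algebraMap K ((MvPolynomial (Fin m) K))) (rename κ H) := by
    rw [sigmaU, aeval_rename]
    have e : (aeval (sigmaUVal K r m c ∘ Subtype.val) : MvPolynomial _ K →ₐ[K] (MvPolynomial (Fin r × Fin m) (MvPolynomial (Fin m) K))) =
        (MvPolynomial.mapAlgHom (Algebra.ofId K ((MvPolynomial (Fin m) K)))).comp (rename κ) :=
      MvPolynomial.algHom_ext fun w => by simp [hval w]
    rw [e]
    rfl
  intro hmem
  rw [hσ, mem_map_C_iff] at hmem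
  apply hH0
  apply rename_injective κ hκinj
  rw [map_zero]
  ext β
  have h := hmem β
  rw [coeff_map] at h
  rw [coeff_zero]
  by_contra hβ
  apply h𝔞
  rw [Ideal.eq_top_iff_one]
  have hu : IsUnit (algebraMap K ((MvPolynomial (Fin m) K)) (coeff β (rename κ H))) := (IsUnit.mk0 _ hβ).map _
  exact (Ideal.eq_top_of_isUnit_mem _ h hu) ▸ Submodule.mem_top

/-- **Some `∂F/∂u_{ic}` is not a multiple of `F`** (`F` a generator of `p̄(r)`, `x_c ∉ 𝔭`): the
variable `u_{ic}` occurs in `F` for some block `i` (otherwise `σ_c(F) ∉ 𝔭' T`), and then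
`∂F/∂u_{ic} ≠ 0` has smaller degree than `F`. Consequently `g = σ_c(∂F/∂u_{ic}) ∉ 𝔭' T`.
[cite: NesterenkoPhilippon2001, Ch. 3 Prop. 4.4 (p. 38)] -/
theorem exists_pderiv_notMem_span [CharZero K] (h𝔭 : 𝔭.IsPrime)
    (hhom : 𝔭.IsHomogeneous (homogeneousSubmodule (Fin (m + 1)) K)) (hc : (X c : (MvPolynomial (Fin (m + 1)) K)) ∉ 𝔭)
    (hr : 1 ≤ r) (hdim : ringKrullDim ((MvPolynomial (Fin (m + 1)) K) ⧸ 𝔭) = r) (hF : Ideal.span {F} = elimIdeal 𝔭 r) :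
    ∃ i : Fin r, pderiv (i, c) F ∉ Ideal.span {F} ∧
      sigmaU K r m c (pderiv (i, c) F) ∉ (affIdeal c 𝔭).map (C : (MvPolynomial (Fin m) K) →+* (MvPolynomial (Fin r × Fin m) (MvPolynomial (Fin m) K))) := by
  classical
  have hF0 : F ≠ 0 := (irreducible_of_span_eq_elimIdeal h𝔭 hhom hr hdim hF).ne_zero
  have hocc : ∃ i : Fin r, (i, c) ∈ F.vars := by
    by_contra hall
    push Not at hall
    have h𝔭' : affIdeal c 𝔭 ≠ ⊤ := (isPrime_affIdeal h𝔭 hhom hc).ne_top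
    exact sigmaU_notMem_of_forall_notMem_vars hF0 hall h𝔭'
      (sigmaU_mem_of_mem_elimIdeal c (hF ▸ Ideal.mem_span_singleton_self F))
  obtain ⟨i, hi⟩ := hocc
  have h1 : pderiv (i, c) F ∉ Ideal.span {F} := pderiv_notMem_span (pderiv_ne_zero_of_mem_vars hi)
  refine ⟨i, h1, fun h2 => h1 ?_⟩
  rw [hF, elimIdeal_eq_comap_sigmaU h𝔭 hhom hc r, Ideal.mem_comap]
  exact h2

end Prime

/-! ### The induction: `fᵃ ∈ 𝔍 ⇒ (𝔭' T)ᵃ ⊆ 𝔍` for `∂`-stable `g`-saturated ideals -/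

section Induction

variable {𝔭 : Ideal (MvPolynomial (Fin (m + 1)) K)} {r : ℕ} {c : Fin (m + 1)} {F : (MvPolynomial (Fin r × Fin (m + 1)) K)}

/-- Powers of `g` can be cancelled in a `g`-saturated ideal. [folklore] -/
theorem mem_of_pow_mul_mem {T : Type*} [CommRing T] {𝔍 : Ideal T} {g : T}
    (hsat : ∀ x, g * x ∈ 𝔍 → x ∈ 𝔍) {e : ℕ} {x : T} (h : g ^ e * x ∈ 𝔍) : x ∈ 𝔍 := by
  induction e with
  | zero => simpa using h
  | succ e ih => exact ih (hsat _ (by rw [← mul_assoc, ← pow_succ']; exact h))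

/-- **The induction.** Let `𝔭` be a homogeneous prime with `p̄(r) = (F)`, `x_c ∉ 𝔭`, `i` a block,
`f = σ_c(F)`, `g = σ_c(∂F/∂u_{ic})`. If an ideal `𝔍 ⊆ T` is stable under the `∂/∂u_{ij'}`
(`j' < m`), saturated with respect to `g`, and contains `fᵃ`, then `(𝔭' T)ᵃ ⊆ 𝔍`. (For `P ∈ 𝔭` a
form, `𝔅 = (𝔍 : fᵃ)` contains `f` and — as `∂(f^{a+1}) = (a+1) fᵃ ∂f` in characteristic `0` —
the `∂f`, so by KEY `gᵉ P(x_c := 1) fᵃ ∈ 𝔍`, `P(x_c := 1) fᵃ ∈ 𝔍`, and the induction hypothesis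
applies to `(𝔍 : P(x_c := 1))`.) [cite: NesterenkoPhilippon2001, Ch. 3 Prop. 4.4 (p. 38)] -/
theorem map_pow_le_of_pow_mem [CharZero K] (h𝔭 : 𝔭.IsPrime)
    (hhom : 𝔭.IsHomogeneous (homogeneousSubmodule (Fin (m + 1)) K)) (hc : (X c : (MvPolynomial (Fin (m + 1)) K)) ∉ 𝔭)
    (hF : Ideal.span {F} = elimIdeal 𝔭 r) {i : Fin r} (a : ℕ) {𝔍 : Ideal ((MvPolynomial (Fin r × Fin m) (MvPolynomial (Fin m) K)))}
    (hD : ∀ x ∈ 𝔍, ∀ j' : Fin m, pderiv (i, j') x ∈ 𝔍)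
    (hsat : ∀ x, sigmaU K r m c (pderiv (i, c) F) * x ∈ 𝔍 → x ∈ 𝔍)
    (hfa : sigmaU K r m c F ^ a ∈ 𝔍) :
    ((affIdeal c 𝔭).map (C : (MvPolynomial (Fin m) K) →+* (MvPolynomial (Fin r × Fin m) (MvPolynomial (Fin m) K)))) ^ a ≤ 𝔍 := by
  induction a generalizing 𝔍 with
  | zero =>
    rw [pow_zero, Ideal.one_eq_top, top_le_iff, Ideal.eq_top_iff_one]
    simpa using hfa
  | succ a ih =>
    set f := sigmaU K r m c F with hf
    set g := sigmaU K r m c (pderiv (i, c) F) with hg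
    -- (1) `P(x_c := 1) fᵃ ∈ 𝔍` for every form `P ∈ 𝔭`
    have hstep : ∀ (P : (MvPolynomial (Fin (m + 1)) K)) (e : ℕ), P.IsHomogeneous e → P ∈ 𝔭 →
        C (ProjectiveSpace.dehomogenize K c P) * f ^ a ∈ 𝔍 := by
      intro P e hP hP𝔭
      have hf𝔅 : f ∈ 𝔍.colon {f ^ a} := by
        rw [Submodule.mem_colon_singleton, smul_eq_mul, ← pow_succ']
        exact hfa
      have hd𝔅 : ∀ j' : Fin m, pderiv (i, j') f ∈ 𝔍.colon {f ^ a} := by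
        intro j'
        rw [Submodule.mem_colon_singleton, smul_eq_mul]
        have h1 := hD _ hfa j'
        rw [Derivation.leibniz_pow, Nat.add_sub_cancel, smul_eq_mul, nsmul_eq_mul] at h1
        have hunit : IsUnit ((a + 1 : ℕ) : (MvPolynomial (Fin r × Fin m) (MvPolynomial (Fin m) K))) := by
          rw [show ((a + 1 : ℕ) : (MvPolynomial (Fin r × Fin m) (MvPolynomial (Fin m) K))) = algebraMap K ((MvPolynomial (Fin r × Fin m) (MvPolynomial (Fin m) K))) (a + 1 : ℕ) by simp]
          exact (IsUnit.mk0 _ (by exact_mod_cast Nat.succ_ne_zero a)).map _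
        rw [mul_comm]
        exact (Ideal.unit_mul_mem_iff_mem 𝔍 hunit).mp h1
      have hkey := pow_mul_C_mem_of_isPrime h𝔭 hhom hc hF hf𝔅 hd𝔅 hP hP𝔭
      rw [Submodule.mem_colon_singleton, smul_eq_mul, mul_assoc] at hkey
      exact mem_of_pow_mul_mem hsat hkey
    -- (2) `(𝔭' T)ᵃ ⊆ (𝔍 : P(x_c := 1))` for every form `P ∈ 𝔭`, by induction
    have hcolon : ∀ (P : (MvPolynomial (Fin (m + 1)) K)) (e : ℕ), P.IsHomogeneous e → P ∈ 𝔭 →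
        ((affIdeal c 𝔭).map (C : (MvPolynomial (Fin m) K) →+* (MvPolynomial (Fin r × Fin m) (MvPolynomial (Fin m) K)))) ^ a ≤
          𝔍.colon {C (ProjectiveSpace.dehomogenize K c P)} := by
      intro P e hP hP𝔭
      refine ih (fun x hx j' => ?_) (fun x hx => ?_) ?_
      · rw [Submodule.mem_colon_singleton, smul_eq_mul] at hx ⊢
        have := hD _ hx j'
        rwa [Derivation.leibniz, pderiv_C, smul_zero, zero_add, smul_eq_mul, mul_comm] at this
      · rw [Submodule.mem_colon_singleton, smul_eq_mul] at hx ⊢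
        exact hsat _ (by rw [← mul_assoc]; exact hx)
      · rw [Submodule.mem_colon_singleton, smul_eq_mul, mul_comm]
        exact hstep P e hP hP𝔭
    -- (3) `(𝔭' T)^{a+1} = 𝔭' T · (𝔭' T)ᵃ ⊆ 𝔍`
    rw [pow_succ', Ideal.mul_le]
    intro x hx y hy
    suffices h : (affIdeal c 𝔭).map (C : (MvPolynomial (Fin m) K) →+* (MvPolynomial (Fin r × Fin m) (MvPolynomial (Fin m) K))) ≤ 𝔍.colon {y} by
      have := h hx
      rwa [Submodule.mem_colon_singleton, smul_eq_mul] at this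
    rw [Ideal.map_le_iff_le_comap]
    intro b hb
    obtain ⟨P₀, hP₀, rfl⟩ := (mem_affIdeal_iff c 𝔭 b).mp hb
    rw [Ideal.mem_comap, Submodule.mem_colon_singleton, smul_eq_mul, ← sum_homogeneousComponent P₀,
      map_sum, map_sum, Finset.sum_mul]
    refine Ideal.sum_mem _ fun k _ => ?_
    have := hcolon _ k (homogeneousComponent_isHomogeneous k P₀)
      (homogeneousComponent_mem_of_isHomogeneous hhom hP₀ k) hy
    rwa [Submodule.mem_colon_singleton, smul_eq_mul, mul_comm] at this

end Induction

/-! ### `Q̄(r) = (F^k)` -/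

section Primary

variable {𝔭 Q : Ideal (MvPolynomial (Fin (m + 1)) K)} {r : ℕ} {c : Fin (m + 1)} {F : (MvPolynomial (Fin r × Fin (m + 1)) K)}

/-- Powers of a homogeneous ideal are homogeneous. [folklore] -/
theorem isHomogeneous_pow_of_isHomogeneous (hhom : 𝔭.IsHomogeneous (homogeneousSubmodule (Fin (m + 1)) K)) :
    ∀ n : ℕ, (𝔭 ^ n).IsHomogeneous (homogeneousSubmodule (Fin (m + 1)) K)
  | 0 => by rw [pow_zero, Ideal.one_eq_top]; exact Ideal.IsHomogeneous.top _
  | n + 1 => by rw [pow_succ]; exact (isHomogeneous_pow_of_isHomogeneous hhom n).mul hhom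

/-- **`𝔭ᵃ ⊆ Q` as soon as `y · fᵃ ∈ Q' T` for some `y ∉ 𝔭' T`** (`Q` a homogeneous `𝔭`-primary
ideal, `x_c ∉ 𝔭`, `f = σ_c(F)`): apply the induction to the `𝔭' T`-saturation
`𝔍 = {x : ∃ y ∉ 𝔭' T, y x ∈ Q' T}` of `Q' T` (stable under the `∂/∂u_{ij'}`, and `g`-saturated as
`g ∉ 𝔭' T`), then descend through the charts: for a form `P ∈ 𝔭ᵃ`, `y P(x_c:=1) ∈ Q' T` gives
coefficientwise `y_α P(x_c := 1) ∈ Q'` with `y_α ∉ 𝔭' = √Q'`, so `P(x_c := 1) ∈ Q'` and `P ∈ Q`.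
[cite: NesterenkoPhilippon2001, Ch. 3 Prop. 4.4 (p. 38)] -/
theorem pow_le_of_exists_mul_pow_mem [CharZero K] (h𝔭 : 𝔭.IsPrime)
    (hhom : 𝔭.IsHomogeneous (homogeneousSubmodule (Fin (m + 1)) K)) (hr : 1 ≤ r)
    (hdim : ringKrullDim ((MvPolynomial (Fin (m + 1)) K) ⧸ 𝔭) = r) (hc : (X c : (MvPolynomial (Fin (m + 1)) K)) ∉ 𝔭)
    (hF : Ideal.span {F} = elimIdeal 𝔭 r) (hQ : Q.IsPrimary)
    (hQhom : Q.IsHomogeneous (homogeneousSubmodule (Fin (m + 1)) K)) (hQrad : Q.radical = 𝔭) {a : ℕ}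
    (h : ∃ y ∉ (affIdeal c 𝔭).map (C : (MvPolynomial (Fin m) K) →+* (MvPolynomial (Fin r × Fin m) (MvPolynomial (Fin m) K))),
      y * sigmaU K r m c F ^ a ∈ (affIdeal c Q).map (C : (MvPolynomial (Fin m) K) →+* (MvPolynomial (Fin r × Fin m) (MvPolynomial (Fin m) K)))) : 𝔭 ^ a ≤ Q := by
  classical
  obtain ⟨i, -, hg⟩ := exists_pderiv_notMem_span h𝔭 hhom hc hr hdim hF
  set 𝔓 : Ideal ((MvPolynomial (Fin r × Fin m) (MvPolynomial (Fin m) K))) := (affIdeal c 𝔭).map (C : (MvPolynomial (Fin m) K) →+* (MvPolynomial (Fin r × Fin m) (MvPolynomial (Fin m) K))) with h𝔓def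
  set 𝔔 : Ideal ((MvPolynomial (Fin r × Fin m) (MvPolynomial (Fin m) K))) := (affIdeal c Q).map (C : (MvPolynomial (Fin m) K) →+* (MvPolynomial (Fin r × Fin m) (MvPolynomial (Fin m) K))) with h𝔔def
  have h𝔓 : 𝔓.IsPrime := isPrime_map_C (isPrime_affIdeal h𝔭 hhom hc)
  have hcQ : (X c : (MvPolynomial (Fin (m + 1)) K)) ∉ Q.radical := by rwa [hQrad]
  -- the `𝔓`-saturation of `𝔔`
  let 𝔍 : Ideal ((MvPolynomial (Fin r × Fin m) (MvPolynomial (Fin m) K))) :=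
    { carrier := {x | ∃ y ∉ 𝔓, y * x ∈ 𝔔}
      zero_mem' := ⟨1, fun h1 => h𝔓.ne_top ((Ideal.eq_top_iff_one _).mpr h1), by
        rw [mul_zero]; exact zero_mem _⟩
      add_mem' := by
        rintro x₁ x₂ ⟨y₁, hy₁, h₁⟩ ⟨y₂, hy₂, h₂⟩
        refine ⟨y₁ * y₂, fun h => (h𝔓.mem_or_mem h).elim hy₁ hy₂, ?_⟩
        rw [show y₁ * y₂ * (x₁ + x₂) = y₂ * (y₁ * x₁) + y₁ * (y₂ * x₂) by ring]
        exact 𝔔.add_mem (𝔔.mul_mem_left _ h₁) (𝔔.mul_mem_left _ h₂)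
      smul_mem' := by
        rintro t x ⟨y, hy, h⟩
        refine ⟨y, hy, ?_⟩
        rw [smul_eq_mul, mul_left_comm]
        exact 𝔔.mul_mem_left _ h }
  have hmem𝔍 : ∀ {x}, x ∈ 𝔍 ↔ ∃ y ∉ 𝔓, y * x ∈ 𝔔 := Iff.rfl
  have hD : ∀ x ∈ 𝔍, ∀ j' : Fin m, pderiv (i, j') x ∈ 𝔍 := by
    intro x hx j'
    obtain ⟨y, hy, hyx⟩ := hmem𝔍.mp hx
    refine hmem𝔍.mpr ⟨y * y, fun h => (h𝔓.mem_or_mem h).elim hy hy, ?_⟩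
    have h1 : pderiv (i, j') (y * x) ∈ 𝔔 := pderiv_mem_map_C _ hyx
    rw [Derivation.leibniz, smul_eq_mul, smul_eq_mul] at h1
    have h2 : pderiv (i, j') y * (y * x) ∈ 𝔔 := 𝔔.mul_mem_left _ hyx
    have := 𝔔.sub_mem (𝔔.mul_mem_left y h1) h2
    rwa [show y * (y * pderiv (i, j') x + x * pderiv (i, j') y) - pderiv (i, j') y * (y * x) =
      y * y * pderiv (i, j') x by ring] at this
  have hsat : ∀ x, sigmaU K r m c (pderiv (i, c) F) * x ∈ 𝔍 → x ∈ 𝔍 := by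
    intro x hx
    obtain ⟨y, hy, hyx⟩ := hmem𝔍.mp hx
    refine hmem𝔍.mpr ⟨y * sigmaU K r m c (pderiv (i, c) F), fun h => (h𝔓.mem_or_mem h).elim hy hg, ?_⟩
    rwa [mul_assoc]
  have hfa : sigmaU K r m c F ^ a ∈ 𝔍 := hmem𝔍.mpr h
  have hle := map_pow_le_of_pow_mem h𝔭 hhom hc hF a hD hsat hfa
  -- descend to `K[x̲]`
  have hQ' : (affIdeal c Q).IsPrimary := isPrimary_affIdeal hQ hQhom hcQ
  have hQ'rad : (affIdeal c Q).radical = affIdeal c 𝔭 := by rw [radical_affIdeal hQ hQhom hcQ, hQrad]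
  have hsatQ : ∀ P : (MvPolynomial (Fin (m + 1)) K), X c * P ∈ Q → P ∈ Q := fun P hP =>
    mem_of_X_pow_mul_mem_of_isPrimary hQ hcQ (n := 1) (by rwa [pow_one])
  have hform : ∀ (P : (MvPolynomial (Fin (m + 1)) K)) (e : ℕ), P.IsHomogeneous e → P ∈ 𝔭 ^ a → P ∈ Q := by
    intro P e hP hPa
    have h1 : C (ProjectiveSpace.dehomogenize K c P) ∈ 𝔓 ^ a := by
      rw [h𝔓def, ← Ideal.map_pow, affIdeal, ← Ideal.map_pow]
      exact Ideal.mem_map_of_mem _ (Ideal.mem_map_of_mem _ hPa)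
    obtain ⟨y, hy, hyP⟩ := hmem𝔍.mp (hle h1)
    rw [h𝔓def, mem_map_C_iff, not_forall] at hy
    obtain ⟨α, hα⟩ := hy
    rw [mul_comm] at hyP
    have h2 := (mem_map_C_iff.mp hyP) α
    rw [coeff_C_mul] at h2
    have h3 : ProjectiveSpace.dehomogenize K c P ∈ affIdeal c Q := by
      rcases (Ideal.isPrimary_iff.mp hQ').2 h2 with h | h
      · exact h
      · exact absurd (hQ'rad ▸ h) hα
    exact mem_of_dehomogenize_mem_affIdeal c hQhom hsatQ hP h3
  intro P hP
  rw [← sum_homogeneousComponent P]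
  exact Ideal.sum_mem _ fun k _ => hform _ k (homogeneousComponent_isHomogeneous k P)
    (homogeneousComponent_mem_of_isHomogeneous (isHomogeneous_pow_of_isHomogeneous hhom a) hP k)

/-- `(A ⊔ B)ᵏ ⊆ Aᵏ ⊔ B` for ideals. [folklore] -/
theorem sup_pow_le {R : Type*} [CommSemiring R] (A B : Ideal R) :
    ∀ k : ℕ, (A ⊔ B) ^ k ≤ A ^ k ⊔ B
  | 0 => by rw [pow_zero, pow_zero]; exact le_sup_left
  | k + 1 => by
    rw [pow_succ, pow_succ]
    refine (Ideal.mul_mono_left (sup_pow_le A B k)).trans ?_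
    rw [Ideal.sup_mul, Ideal.mul_sup, Ideal.mul_sup]
    refine sup_le (sup_le le_sup_left ?_) (sup_le ?_ ?_)
    · exact Ideal.mul_le_left.trans le_sup_right
    · exact Ideal.mul_le_right.trans le_sup_right
    · exact Ideal.mul_le_right.trans le_sup_right

/-- `G ∈ Ī(r) ⇒ Gᵏ ∈ (Iᵏ)‾(r)` (`(G xⱼ^M)ᵏ ∈ (I, L)ᵏ ⊆ (Iᵏ, L)`).
[cite: NesterenkoPhilippon2001, Ch. 3 Def. 4.3 (p. 38)] -/
theorem pow_mem_elimIdeal_pow {I : Ideal (MvPolynomial (Fin (m + 1)) K)} {r : ℕ} {G : (MvPolynomial (Fin r × Fin (m + 1)) K)} (hG : G ∈ elimIdeal I r)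
    {k : ℕ} (hk : 0 < k) : G ^ k ∈ elimIdeal (I ^ k) r := by
  obtain ⟨M, hM, hGM⟩ := hG
  refine ⟨M * k, Nat.mul_pos hM hk, fun j => ?_⟩
  have h1 : (rename Sum.inl G * X (Sum.inr j) ^ M) ^ k ∈ extIdeal I r ^ k := Ideal.pow_mem_pow (hGM j) k
  rw [mul_pow, ← pow_mul, ← map_pow] at h1
  refine (sup_pow_le _ _ k).trans ?_ h1
  rw [← Ideal.map_pow]
  exact le_rfl

/-- **LNM 1752 Ch. 3 Prop. 4.4, primary case: `Q̄(r) = (Fᵏ)`.** For a homogeneous prime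
`𝔭 ⊂ K[x₀, …, x_m]` with `dim K[x̲] ⧸ 𝔭 = r ≥ 1` and associated form `F` (`p̄(r) = (F)`), and a
homogeneous `𝔭`-primary ideal `Q` of exponent `k` (the least `k` with `𝔭ᵏ ⊆ Q`):
`elimIdeal Q r = (F ^ k)`. (`⊇`: `(𝔭, L)ᵏ ⊆ (Q, L)`. `⊆`: write `G = Fᵃ G'` with `F ∤ G'`; then
`σ_c(G') ∉ 𝔭' T` and `σ_c(G') fᵃ ∈ Q' T`, so `𝔭ᵃ ⊆ Q` by `pow_le_of_exists_mul_pow_mem`, whence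
`k ≤ a`.) [cite: NesterenkoPhilippon2001, Ch. 3 Prop. 4.4 (p. 38)] -/
theorem elimIdeal_eq_span_pow_of_isPrimary [CharZero K] (h𝔭 : 𝔭.IsPrime)
    (hhom : 𝔭.IsHomogeneous (homogeneousSubmodule (Fin (m + 1)) K)) (hr : 1 ≤ r)
    (hdim : ringKrullDim ((MvPolynomial (Fin (m + 1)) K) ⧸ 𝔭) = r) (hQ : Q.IsPrimary)
    (hQhom : Q.IsHomogeneous (homogeneousSubmodule (Fin (m + 1)) K)) (hQrad : Q.radical = 𝔭)
    (hF : Ideal.span {F} = elimIdeal 𝔭 r) {k : ℕ} (hk : 0 < k) (hkQ : 𝔭 ^ k ≤ Q)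
    (hkmin : ∀ a, 𝔭 ^ a ≤ Q → k ≤ a) :
    elimIdeal Q r = Ideal.span {F ^ k} := by
  classical
  obtain ⟨c, hc⟩ := exists_X_notMem_of_rank h𝔭 hr hdim
  have hFirr := irreducible_of_span_eq_elimIdeal h𝔭 hhom hr hdim hF
  apply le_antisymm
  · intro G hG
    rw [Ideal.mem_span_singleton]
    by_cases hG0 : G = 0
    · rw [hG0]; exact dvd_zero _
    obtain ⟨a, G', hndvd, rfl⟩ := WfDvdMonoid.max_power_factor hG0 hFirr
    have hG' : sigmaU K r m c G' ∉ (affIdeal c 𝔭).map (C : (MvPolynomial (Fin m) K) →+* (MvPolynomial (Fin r × Fin m) (MvPolynomial (Fin m) K))) := by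
      intro h
      apply hndvd
      rw [← Ideal.mem_span_singleton, hF, elimIdeal_eq_comap_sigmaU h𝔭 hhom hc r, Ideal.mem_comap]
      exact h
    have hmem : sigmaU K r m c G' * sigmaU K r m c F ^ a ∈ (affIdeal c Q).map (C : (MvPolynomial (Fin m) K) →+* (MvPolynomial (Fin r × Fin m) (MvPolynomial (Fin m) K))) := by
      have := sigmaU_mem_of_mem_elimIdeal c hG
      rwa [map_mul, map_pow, mul_comm] at this
    have ha := hkmin a (pow_le_of_exists_mul_pow_mem h𝔭 hhom hr hdim hc hF hQ hQhom hQrad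
      ⟨_, hG', hmem⟩)
    exact (pow_dvd_pow F ha).mul_right G'
  · rw [Ideal.span_singleton_le_iff_mem]
    have hF𝔭 : F ∈ elimIdeal 𝔭 r := hF ▸ Ideal.mem_span_singleton_self F
    exact elimIdeal_mono hkQ r (pow_mem_elimIdeal_pow hF𝔭 hk)

end Primary

end NesterenkoK

end Literature.NumberTheory.Transcendental
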